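import Mathlib.LinearAlgebra.Matrix.Rank
import Mathlib.LinearAlgebra.Matrix.ToLinearEquiv
import Mathlib.LinearAlgebra.Matrix.NonsingularInverse
import Mathlib.Tactic.LinearCombination
import Literature.Computability.AlgebraicComplexity.HessianAtOrigin
import Literature.Computability.AlgebraicComplexity.DeterminantalComplexityProofs
import Literature.Computability.AlgebraicComplexity.PermanentVsDeterminant
import HarnessLib

/-!
# The Mignon–Ressayre bound `dc(per_n) ≥ n² / 2`

Companion proofs file of `Literature/Computability/AlgebraicComplexity/PermanentVsDeterminant.lean`
(next to `PermanentVsDeterminantProofs.lean`, which holds Grenet's upper bound):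
`sq_le_two_mul_determinantalComplexity_perPoly_complex_holds` DISCHARGES the named fact
`sq_le_two_mul_determinantalComplexity_perPoly_complex` — for `n ≥ 3` the determinantal complexity
of the `n × n` permanent over `ℂ` satisfies `n² ≤ 2 · dc(PER_n)` (Mignon–Ressayre 2004, Thm. 1.1;
Landsberg 2017, Thm. 6.4.6.4). The vocabulary (`hess0`, `linPart`, `transl`, `mrPoint`, `mrHess`)
is in `HessianAtOrigin.lean`.

## The proof formalised here

Let `per_n = det A` with `A` an `M × M` matrix of affine linear forms (`HasDetRepr`), `n = m + 3`.
1. *Rank bound* (`rank_hess0_det_le`): if `A` is a square matrix of affine linear forms over a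
   field with `(det A)(0) = 0`, the Hessian of `det A` at the origin has rank `≤ 2M`. Instead of
   the normal form of Mignon–Ressayre (who compute the Hessian of `det_M` at a corank-one point,
   of rank exactly `2M`) we argue directly: `A(0)` is singular, so `cᵀ A(0) = 0` for some `c ≠ 0`
   (`Matrix.exists_vecMul_eq_zero_iff`); replacing `A` by `V A` with `V = 1.updateRow i₀ c`
   (`det V = c_{i₀} ≠ 0`) rescales `det A` by a non-zero constant and makes row `i₀` vanish at
   `0`; Laplace expansion along that row and the product rule (`hess0_mul`; affine entries have
   zero Hessian) write the Hessian as a sum of `M` matrices `a bᵀ + b aᵀ`, each of rank `≤ 2`.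
   This is the substitution principle of Landsberg 2017, Exercise 6.4.5.2 combined with the
   rank-`2M` computation of Mignon–Ressayre 2004, §2.
2. *The point* (`eval_mrPoint_perPoly`): `per(y₀) = 0` for the Mignon–Ressayre point `y₀`
   (Landsberg 2017, Exercise 6.4.6.1), by counting permutations with one prescribed value.
3. *The Hessian of the permanent* (`hess0_transl_perPoly`, `hess0_transl_mrPoint_perPoly`):
   `∂_{cd} ∂_{ab} per` is the sub-permanent with rows `a, c` and columns `b, d` removed; at `y₀`
   this gives `m! · mrHess` (Landsberg 2017, Exercise 6.4.6.2 / (6.4.3)), by counting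
   permutations with two and three prescribed values (`card_perm_forall_apply_eq`).
4. *Nonsingularity* (`mrHess_mulVec_eq_zero_imp`, `rank_mrHess`): the block argument of
   Landsberg 2017, Lemma 6.4.6.3 (with the injectivity of the blocks `Q`, `R` proved here:
   `eq_zero_of_mrQ`, `eq_zero_of_mrR`), in characteristic `0`; hence `rank = n²`.
5. *Assembly* (`sq_le_two_mul_of_hasDetRepr_perPoly`): translating by `y₀` (`transl`, which keeps
   entries affine and commutes with `det`), `n² = rank H(per(X + y₀))(0) ≤ 2M`; the infimum `dc`
   is attained by Valiant universality (`exists_hasDetRepr_holds`).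

## References

* T. Mignon, N. Ressayre, *A quadratic bound for the determinant and permanent problem*,
  Int. Math. Res. Not. 2004, no. 79, 4241–4253, Thm. 1.1, §§2–3 (key `MignonRessayre2004`).
* J. M. Landsberg, *Geometry and Complexity Theory*, CUP 2017, §6.4.5 (Prop. 6.4.5.1,
  Exercise 6.4.5.2), §6.4.6 (Exercises 6.4.6.1–2, (6.4.3), Lemma 6.4.6.3, Thm. 6.4.6.4)
  (key `LandsbergGCT2017`).

## Design notes

* Everything is stated for the size `m + 3` (`m : ℕ`), so that the index `0 : Fin (m + 3)` exists
  and no natural subtraction appears; the discharge rewrites `n = m + 3` from `3 ≤ n`.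
* The general-characteristic version `sq_le_two_mul_determinantalComplexity_perPoly`
  (Cai–Chen–Li 2010, characteristic `≠ 2`) is NOT proved here: the point `y₀` and the
  characteristic-`0` counting (`m + 1`, `m + 2`, `2`, `m!` invertible) are specific to `ℂ`/`ℚ`.
* Mathlib has no `Matrix.rank_add_le` / `rank_smul`; the small rank lemmas (`rank_sum_le`,
  `rank_smul_le`, `rank_smul_eq`) are proved locally (cf. the private copies in
  `Literature/Combinatorics/Additive/SliceRankMethod.lean` and the two-summand
  `Literature.Barriers.Schanuel.rank_add_le_rank_add_rank`, not imported to keep the import graph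
  topical).
-/

noncomputable section

open MvPolynomial Matrix

namespace Literature.Computability.AlgebraicComplexity

/-! ### Translation keeps affine forms affine -/

section TranslDegree

variable {k : Type*} [CommRing k] {σ : Type*}

/-- Translation does not raise the total degree. [folklore] -/
theorem totalDegree_transl_le (x : σ → k) (f : MvPolynomial σ k) :
    (transl x f).totalDegree ≤ f.totalDegree := by
  refine HasDetRepr.totalDegree_aeval_le_of_le_one _ (fun s => ?_) f
  refine (totalDegree_add _ _).trans (max_le ?_ ?_)
  · simpa [X, Finsupp.sum_single_index] using
      totalDegree_monomial_le (R := k) (Finsupp.single s 1) 1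
  · rw [totalDegree_C]; exact Nat.zero_le _


end TranslDegree

/-! ### Rank lemmas over a field -/

section Rank

variable {K : Type*} [Field K]

/-- Subadditivity of the rank over a finite sum: `rank (Σ Aᵢ) ≤ Σ rank Aᵢ` (the range of a sum
lies in the sum of the ranges; the two-summand case is also
`Literature.Barriers.Schanuel.rank_add_le_rank_add_rank`, not imported here). [folklore] -/
theorem rank_sum_le {m n ι : Type*} [Fintype m] [Fintype n] (s : Finset ι)
    (A : ι → Matrix m n K) : (∑ i ∈ s, A i).rank ≤ ∑ i ∈ s, (A i).rank := by
  classical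
  have hadd : ∀ A B : Matrix m n K, (A + B).rank ≤ A.rank + B.rank := by
    intro A B
    unfold Matrix.rank
    rw [Matrix.mulVecLin_add]
    calc Module.finrank K (LinearMap.range (A.mulVecLin + B.mulVecLin))
        ≤ Module.finrank K ↥(LinearMap.range A.mulVecLin ⊔ LinearMap.range B.mulVecLin) := by
          apply Submodule.finrank_mono
          rintro _ ⟨v, rfl⟩
          exact Submodule.add_mem_sup ⟨v, rfl⟩ ⟨v, rfl⟩
      _ ≤ _ := Submodule.finrank_add_le_finrank_add_finrank _ _
  induction s using Finset.induction_on with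
  | empty => simp
  | insert a s ha ih =>
      rw [Finset.sum_insert ha, Finset.sum_insert ha]
      exact (hadd _ _).trans (Nat.add_le_add_left ih _)

/-- Scaling does not raise the rank. [folklore] -/
theorem rank_smul_le {m n : Type*} [Fintype m] [Fintype n] (c : K) (A : Matrix m n K) :
    (c • A).rank ≤ A.rank := by
  by_cases hc : c = 0
  · simp [hc]
  · have h : (c • A).mulVecLin = c • A.mulVecLin := by
      apply LinearMap.ext
      intro v
      simp
    unfold Matrix.rank
    rw [h, LinearMap.range_smul _ _ hc]

/-- Scaling by a non-zero constant does not change the rank. [folklore] -/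
theorem rank_smul_eq {m n : Type*} [Fintype m] [Fintype n] {c : K} (hc : c ≠ 0)
    (A : Matrix m n K) : (c • A).rank = A.rank := by
  refine le_antisymm (rank_smul_le c A) ?_
  conv_lhs => rw [show A = c⁻¹ • (c • A) by rw [smul_smul, inv_mul_cancel₀ hc, one_smul]]
  exact rank_smul_le _ _

/-- A sum of two rank-one matrices `a bᵀ + c dᵀ` has rank `≤ 2`. [folklore] -/
theorem rank_vecMulVec_add_vecMulVec_le {σ : Type*} [Fintype σ] (a b c d : σ → K) :
    (vecMulVec a b + vecMulVec c d).rank ≤ 2 := by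
  have h := rank_sum_le (Finset.univ : Finset (Fin 2)) ![vecMulVec a b, vecMulVec c d]
  rw [Fin.sum_univ_two, Fin.sum_univ_two] at h
  simp only [Matrix.cons_val_zero, Matrix.cons_val_one] at h
  exact h.trans (Nat.add_le_add (rank_vecMulVec_le _ _) (rank_vecMulVec_le _ _))

end Rank

/-! ### The rank of the Hessian of a determinant of affine forms -/

section DetHessian

variable {K : Type*} [Field K] {σ : Type*} [Fintype σ]

/-- If the row `i₀` of a matrix `B` of affine linear forms vanishes at the origin, then the
Hessian of `det B` at the origin is a sum of `n + 1` symmetrised rank-one matrices (Laplace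
expansion along the row `i₀` and the product rule), hence has rank `≤ 2 (n + 1)`.
(Mignon–Ressayre 2004, proof of Thm. 1.1: the Hessian of `det` at a corank-one point has rank
`2m`.) [folklore] -/
theorem rank_hess0_det_le_of_row {n : ℕ} (B : Matrix (Fin (n + 1)) (Fin (n + 1)) (MvPolynomial σ K))
    (i₀ : Fin (n + 1)) (hdeg : ∀ j, (B i₀ j).totalDegree ≤ 1)
    (hcc : ∀ j, constantCoeff (B i₀ j) = 0) :
    (hess0 B.det).rank ≤ 2 * (n + 1) := by
  classical
  have hdet : hess0 B.det = ∑ j : Fin (n + 1), ((-1 : K) ^ (i₀ + j : ℕ)) •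
      (vecMulVec (linPart (B i₀ j)) (linPart (B.submatrix i₀.succAbove j.succAbove).det) +
        vecMulVec (linPart (B.submatrix i₀.succAbove j.succAbove).det) (linPart (B i₀ j))) := by
    rw [Matrix.det_succ_row B i₀, map_sum]
    refine Finset.sum_congr rfl fun j _ => ?_
    rw [show ((-1 : MvPolynomial σ K) ^ (i₀ + j : ℕ)) = C ((-1 : K) ^ (i₀ + j : ℕ)) by simp,
      mul_assoc, hess0_C_mul, hess0_mul, hess0_eq_zero_of_totalDegree_le_one (hdeg j), hcc j]
    simp
  rw [hdet]
  refine (rank_sum_le _ _).trans ?_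
  refine (Finset.sum_le_sum fun j _ =>
    (rank_smul_le _ _).trans (rank_vecMulVec_add_vecMulVec_le _ _ _ _)).trans ?_
  simp [mul_comm]

/-- **Rank bound** (the determinantal half of Mignon–Ressayre's argument, in an elementary
form). Let `A` be an `m × m` matrix of affine linear forms over a field with `(det A)(0) = 0`.
Then the Hessian of `det A` at the origin has rank `≤ 2m`: a non-zero vector `c` with
`cᵀ A(0) = 0` exists; replacing `A` by `V A` with `V` invertible and `i₀`-th row `c` multiplies
`det A` by the constant `det V ≠ 0` and makes the row `i₀` vanish at the origin, and then
`rank_hess0_det_le_of_row` applies. (Mignon–Ressayre 2004, §2 and proof of Thm. 1.1, where the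
bound `rank H_{det}(A(0)) ≤ 2m` at a corank-one point is obtained from a normal form;
Landsberg 2017, Exercise 6.4.5.2 for the behaviour under affine substitution.)
[folklore] -/
theorem rank_hess0_det_le {m : ℕ} (A : Matrix (Fin m) (Fin m) (MvPolynomial σ K))
    (hA : ∀ i j, (A i j).totalDegree ≤ 1) (h0 : constantCoeff A.det = 0) :
    (hess0 A.det).rank ≤ 2 * m := by
  classical
  cases m with
  | zero =>
      exfalso
      rw [Matrix.det_isEmpty, map_one] at h0
      exact one_ne_zero h0
  | succ n =>
    set Λ : Matrix (Fin (n + 1)) (Fin (n + 1)) K := A.map constantCoeff with hΛ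
    have hΛdet : Λ.det = 0 := by
      rw [hΛ, ← RingHom.mapMatrix_apply, ← RingHom.map_det, h0]
    obtain ⟨c, hc0, hcΛ⟩ := Matrix.exists_vecMul_eq_zero_iff.mpr hΛdet
    obtain ⟨i₀, hi₀⟩ := Function.ne_iff.mp hc0
    set V : Matrix (Fin (n + 1)) (Fin (n + 1)) K := (1 : Matrix _ _ K).updateRow i₀ c with hV
    have hVdet : V.det = c i₀ := by
      have hc : c = ∑ l, c l • (1 : Matrix (Fin (n + 1)) (Fin (n + 1)) K) l := by
        ext j
        simp [Finset.sum_apply, Matrix.one_apply]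
      rw [hV]
      conv_lhs => rw [hc]
      rw [Matrix.det_updateRow_sum, Matrix.det_one, smul_eq_mul, mul_one]
    set B : Matrix (Fin (n + 1)) (Fin (n + 1)) (MvPolynomial σ K) :=
      V.map (C : K →+* MvPolynomial σ K) * A with hB
    have hBdet : B.det = C V.det * A.det := by
      rw [hB, Matrix.det_mul, ← RingHom.mapMatrix_apply, ← RingHom.map_det]
    have hBdeg : ∀ i j, (B i j).totalDegree ≤ 1 := by
      intro i j
      rw [hB, Matrix.mul_apply]
      refine totalDegree_finsetSum_le fun l _ => ?_
      rw [Matrix.map_apply]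
      refine (totalDegree_mul _ _).trans ?_
      rw [totalDegree_C, zero_add]
      exact hA l j
    have hBcc : ∀ j, constantCoeff (B i₀ j) = 0 := by
      intro j
      have h := congrFun hcΛ j
      change ∑ l, c l * Λ l j = 0 at h
      rw [hB, Matrix.mul_apply, map_sum]
      simp only [Matrix.map_apply, map_mul, constantCoeff_C, hV, Matrix.updateRow_self]
      simpa [hΛ] using h
    have hBhess : hess0 B.det = V.det • hess0 A.det := by
      rw [hBdet, hess0_C_mul]
    have key := rank_hess0_det_le_of_row B i₀ (fun j => hBdeg i₀ j) hBcc
    rwa [hBhess, rank_smul_eq (by rw [hVdet]; exact hi₀)] at key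

end DetHessian

/-! ### Counting permutations with prescribed values -/

section PermCount

/-- The number of permutations of a finite type taking `j` prescribed distinct values at `j`
distinct points is `(card α - j)!`. [folklore] -/
theorem card_perm_forall_apply_eq (j : ℕ) :
    ∀ (α : Type*) [Fintype α] [DecidableEq α] (x y : Fin j → α),
      Function.Injective x → Function.Injective y →
      Fintype.card {π : Equiv.Perm α // ∀ i, π (x i) = y i} = (Fintype.card α - j).factorial := by
  induction j with
  | zero =>
      intro α _ _ x y _ _
      rw [Fintype.card_congr (Equiv.subtypeUnivEquiv fun (π : Equiv.Perm α) (i : Fin 0) => i.elim0),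
        Fintype.card_perm, Nat.sub_zero]
  | succ j ih =>
      intro α _ _ x y hx hy
      have hxb : ∀ i : Fin j, x i.succ ≠ x 0 := fun i h => Fin.succ_ne_zero i (hx h)
      have hyb : ∀ i : Fin j, Equiv.swap (y 0) (x 0) (y i.succ) ≠ x 0 := by
        intro i h
        rw [Equiv.swap_apply_eq_iff, Equiv.swap_apply_right] at h
        exact Fin.succ_ne_zero i (hy h)
      let x' : Fin j → {z // z ≠ x 0} := fun i => ⟨x i.succ, hxb i⟩
      let y' : Fin j → {z // z ≠ x 0} := fun i => ⟨Equiv.swap (y 0) (x 0) (y i.succ), hyb i⟩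
      have hx' : Function.Injective x' := fun i i' h =>
        Fin.succ_injective _ (hx (congrArg Subtype.val h :))
      have hy' : Function.Injective y' := fun i i' h =>
        Fin.succ_injective _ (hy ((Equiv.swap (y 0) (x 0)).injective (congrArg Subtype.val h :)))
      have e₁ : {π : Equiv.Perm α // ∀ i, π (x i) = y i} ≃
          {π : Equiv.Perm α // π (x 0) = x 0 ∧
            ∀ i : Fin j, π (x i.succ) = Equiv.swap (y 0) (x 0) (y i.succ)} :=
        Equiv.subtypeEquiv (Equiv.mulLeft (Equiv.swap (y 0) (x 0))) fun π => by
          rw [Fin.forall_fin_succ]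
          simp only [Equiv.coe_mulLeft, Equiv.Perm.mul_apply, Equiv.apply_eq_iff_eq]
          rw [Equiv.swap_apply_eq_iff, Equiv.swap_apply_right]
      have e₂ : {ρ : Equiv.Perm {z // z ≠ x 0} // ∀ i, ρ (x' i) = y' i} ≃
          {f : {f : Equiv.Perm α // ∀ z, ¬ z ≠ x 0 → f z = z} //
            ∀ i : Fin j, f.1 (x i.succ) = Equiv.swap (y 0) (x 0) (y i.succ)} :=
        Equiv.subtypeEquiv (Equiv.Perm.subtypeEquivSubtypePerm fun z => z ≠ x 0) fun ρ => by
          refine forall_congr' fun i => ?_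
          rw [Subtype.ext_iff, Equiv.Perm.subtypeEquivSubtypePerm_apply_of_mem ρ (hxb i)]
      have e₃ : {f : {f : Equiv.Perm α // ∀ z, ¬ z ≠ x 0 → f z = z} //
            ∀ i : Fin j, f.1 (x i.succ) = Equiv.swap (y 0) (x 0) (y i.succ)} ≃
          {f : Equiv.Perm α // (∀ z, ¬ z ≠ x 0 → f z = z) ∧
            ∀ i : Fin j, f (x i.succ) = Equiv.swap (y 0) (x 0) (y i.succ)} :=
        Equiv.subtypeSubtypeEquivSubtypeInter (fun f : Equiv.Perm α => ∀ z, ¬ z ≠ x 0 → f z = z)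
          (fun f : Equiv.Perm α => ∀ i : Fin j, f (x i.succ) = Equiv.swap (y 0) (x 0) (y i.succ))
      have e₄ : {f : Equiv.Perm α // (∀ z, ¬ z ≠ x 0 → f z = z) ∧
            ∀ i : Fin j, f (x i.succ) = Equiv.swap (y 0) (x 0) (y i.succ)} ≃
          {π : Equiv.Perm α // π (x 0) = x 0 ∧
            ∀ i : Fin j, π (x i.succ) = Equiv.swap (y 0) (x 0) (y i.succ)} :=
        Equiv.subtypeEquivRight fun π => by simp only [ne_eq, not_not, forall_eq]
      rw [Fintype.card_congr e₁, ← Fintype.card_congr ((e₂.trans e₃).trans e₄), ih _ x' y' hx' hy',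
        Fintype.card_subtype_compl, Fintype.card_subtype_eq, Nat.sub_sub, Nat.add_comm]

/-- Permutations with one prescribed value: `#{π | π b = a} = (card α - 1)!`. [folklore] -/
theorem card_perm_apply_eq_one {α : Type*} [Fintype α] [DecidableEq α] (b a : α) :
    Fintype.card {π : Equiv.Perm α // π b = a} = (Fintype.card α - 1).factorial := by
  rw [← card_perm_forall_apply_eq 1 α ![b] ![a] (Function.injective_of_subsingleton _)
    (Function.injective_of_subsingleton _)]
  exact Fintype.card_congr (Equiv.subtypeEquivRight fun π => by simp)

/-- Permutations with two prescribed values: `#{π | π b = a, π d = c} = (card α - 2)!` for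
`b ≠ d`, `a ≠ c`. [folklore] -/
theorem card_perm_apply_eq_two {α : Type*} [Fintype α] [DecidableEq α] {b d a c : α}
    (hbd : b ≠ d) (hac : a ≠ c) :
    Fintype.card {π : Equiv.Perm α // π b = a ∧ π d = c} = (Fintype.card α - 2).factorial := by
  have hx : Function.Injective ![b, d] := by
    intro i j h; fin_cases i <;> fin_cases j <;> simp_all [eq_comm]
  have hy : Function.Injective ![a, c] := by
    intro i j h; fin_cases i <;> fin_cases j <;> simp_all [eq_comm]
  rw [← card_perm_forall_apply_eq 2 α ![b, d] ![a, c] hx hy]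
  exact Fintype.card_congr (Equiv.subtypeEquivRight fun π => by simp [Fin.forall_fin_two])

/-- Permutations with three prescribed values: `(card α - 3)!` of them. [folklore] -/
theorem card_perm_apply_eq_three {α : Type*} [Fintype α] [DecidableEq α] {b d e a c f : α}
    (hbd : b ≠ d) (hbe : b ≠ e) (hde : d ≠ e) (hac : a ≠ c) (haf : a ≠ f) (hcf : c ≠ f) :
    Fintype.card {π : Equiv.Perm α // π b = a ∧ π d = c ∧ π e = f} =
      (Fintype.card α - 3).factorial := by
  have hx : Function.Injective ![b, d, e] := by
    intro i j h; fin_cases i <;> fin_cases j <;> simp_all [eq_comm]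
  have hy : Function.Injective ![a, c, f] := by
    intro i j h; fin_cases i <;> fin_cases j <;> simp_all [eq_comm]
  rw [← card_perm_forall_apply_eq 3 α ![b, d, e] ![a, c, f] hx hy]
  exact Fintype.card_congr (Equiv.subtypeEquivRight fun π => by
    simp [Fin.forall_fin_succ])

end PermCount

/-! ### The Hessian of the generic permanent -/

section PermanentHessian

variable {k : Type*} [CommRing k]

/-- Leibniz rule for a partial derivative of a finite product. [folklore] -/
theorem pderiv_finset_prod {σ ι : Type*} [DecidableEq ι] (t : σ) (s : Finset ι)
    (f : ι → MvPolynomial σ k) :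
    pderiv t (∏ i ∈ s, f i) = ∑ i ∈ s, (∏ j ∈ s.erase i, f j) * pderiv t (f i) := by
  induction s using Finset.induction_on with
  | empty => simp
  | insert a s ha ih =>
    rw [Finset.prod_insert ha, pderiv_mul, ih, Finset.sum_insert ha, Finset.erase_insert ha,
      Finset.mul_sum]
    congr 1
    · ring
    · refine Finset.sum_congr rfl fun i hi => ?_
      have hia : a ≠ i := fun h => ha (h ▸ hi)
      rw [Finset.erase_insert_of_ne hia,
        Finset.prod_insert fun h => ha (Finset.mem_of_mem_erase h)]
      ring

variable {n : ℕ}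

/-- The partial derivative `∂/∂X_{ab}` of the permutation monomial `∏_{i ∈ S} X_{π i, i}`: it is
`∏_{i ∈ S, i ≠ b} X_{π i, i}` if `b ∈ S` and `π b = a`, and `0` otherwise. [folklore] -/
theorem pderiv_prod_X_perm (S : Finset (Fin n)) (π : Equiv.Perm (Fin n)) (a b : Fin n) :
    pderiv (a, b) (∏ i ∈ S, (X (π i, i) : MvPolynomial (Fin n × Fin n) k)) =
      if b ∈ S ∧ π b = a then ∏ i ∈ S.erase b, X (π i, i) else 0 := by
  classical
  rw [pderiv_finset_prod]
  simp only [pderiv_X]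
  by_cases h : b ∈ S ∧ π b = a
  · rw [if_pos h, Finset.sum_eq_single_of_mem b h.1]
    · rw [show ((π b, b) : Fin n × Fin n) = (a, b) from Prod.ext h.2 rfl, Pi.single_eq_same,
        mul_one]
    · intro i _ hib
      rw [Pi.single_eq_of_ne (fun h' => hib (congrArg Prod.snd h')), mul_zero]
  · rw [if_neg h]
    refine Finset.sum_eq_zero fun i hi => ?_
    rw [Pi.single_eq_of_ne, mul_zero]
    intro h'
    obtain ⟨h1, h2⟩ := Prod.ext_iff.mp h'
    dsimp only at h1 h2
    subst h2
    exact h ⟨hi, h1⟩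

/-- Second partial derivatives of a permutation monomial `∏ᵢ X_{π i, i}`:
`∂_{cd} ∂_{ab} ∏ᵢ X_{π i, i} = ∏_{i ≠ b, d} X_{π i, i}` if `π b = a`, `π d = c`, `b ≠ d`, and `0`
otherwise. [folklore] -/
theorem pderiv_pderiv_prod_X_perm (π : Equiv.Perm (Fin n)) (a b c d : Fin n) :
    pderiv (c, d) (pderiv (a, b) (∏ i, (X (π i, i) : MvPolynomial (Fin n × Fin n) k))) =
      if π b = a ∧ d ≠ b ∧ π d = c then ∏ i ∈ (Finset.univ.erase b).erase d, X (π i, i)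
      else 0 := by
  rw [pderiv_prod_X_perm]
  by_cases h1 : π b = a
  · rw [if_pos ⟨Finset.mem_univ b, h1⟩, pderiv_prod_X_perm]
    by_cases h2 : d ≠ b ∧ π d = c
    · rw [if_pos ⟨Finset.mem_erase.mpr ⟨h2.1, Finset.mem_univ d⟩, h2.2⟩, if_pos ⟨h1, h2⟩]
    · rw [if_neg, if_neg]
      · exact fun h => h2 h.2
      · exact fun h => h2 ⟨(Finset.mem_erase.mp h.1).1, h.2⟩
  · rw [if_neg (fun h => h1 h.2), map_zero, if_neg (fun h => h1 h.1)]

/-- **Second partial derivatives of the generic permanent**: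
`∂_{cd} ∂_{ab} per_n = Σ_{π : π b = a, π d = c, b ≠ d} ∏_{i ≠ b, d} X_{π i, i}`, the generic
`(n-2) × (n-2)` sub-permanent with rows `a, c` and columns `b, d` removed (Mignon–Ressayre 2004,
§3; Landsberg 2017, §6.4.6). [folklore] -/
theorem pderiv_pderiv_perPoly (a b c d : Fin n) :
    pderiv (c, d) (pderiv (a, b) (perPoly (Fin n) k)) = ∑ π : Equiv.Perm (Fin n),
      if π b = a ∧ d ≠ b ∧ π d = c then ∏ i ∈ (Finset.univ.erase b).erase d, X (π i, i)
      else 0 := by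
  simp only [perPoly, Matrix.permanent, Matrix.mvPolynomialX_apply, map_sum]
  exact Finset.sum_congr rfl fun π _ => pderiv_pderiv_prod_X_perm π a b c d

/-- **Hessian of the permanent at a point** `x`: the entry `((c,d),(a,b))` of the Hessian of
`per_n(X + x)` at the origin is `Σ_{π : π b = a, π d = c, b ≠ d} ∏_{i ≠ b, d} x_{π i, i}`, i.e. the
`(n-2) × (n-2)` sub-permanent of `x` with rows `a, c` and columns `b, d` removed (and `0` if
`a = c` or `b = d`) (Mignon–Ressayre 2004, §3; Landsberg 2017, §6.4.6). [folklore] -/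
theorem hess0_transl_perPoly (x : Fin n × Fin n → k) (a b c d : Fin n) :
    hess0 (transl x (perPoly (Fin n) k)) (c, d) (a, b) = ∑ π : Equiv.Perm (Fin n),
      if π b = a ∧ d ≠ b ∧ π d = c then ∏ i ∈ (Finset.univ.erase b).erase d, x (π i, i)
      else 0 := by
  rw [hess0_transl, pderiv_pderiv_perPoly, map_sum]
  refine Finset.sum_congr rfl fun π _ => ?_
  split_ifs
  · simp [map_prod]
  · simp

/-! ### The Mignon–Ressayre point -/

variable {m : ℕ}

/-- A product of entries of the Mignon–Ressayre point along a partial permutation is `-(m+2)` if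
it passes through the `(0,0)` entry and `1` otherwise. [folklore] -/
theorem prod_mrPoint (S : Finset (Fin (m + 3))) (π : Equiv.Perm (Fin (m + 3))) :
    ∏ i ∈ S, mrPoint k m (π i, i) = if 0 ∈ S ∧ π 0 = 0 then -((m : k) + 2) else 1 := by
  by_cases h : 0 ∈ S ∧ π 0 = 0
  · rw [if_pos h, Finset.prod_eq_single_of_mem (0 : Fin (m + 3)) h.1]
    · simp [mrPoint, h.2]
    · intro i _ hi
      simp [mrPoint, hi]
  · rw [if_neg h]
    refine Finset.prod_eq_one fun i hi => ?_
    simp only [mrPoint]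
    rw [if_neg]
    rintro ⟨h1, h2⟩
    subst h2
    exact h ⟨hi, h1⟩

/-- **The Mignon–Ressayre point lies on the permanental hypersurface**: `per(y₀) = 0`
(Landsberg 2017, Exercise 6.4.6.1; Mignon–Ressayre 2004, §3): expanding,
`per(y₀) = -(m+2) · (m+2)! + ((m+3)! - (m+2)!) = 0`. [cite: LandsbergGCT2017, Exercise 6.4.6.1] -/
theorem eval_mrPoint_perPoly :
    eval (mrPoint k m) (perPoly (Fin (m + 3)) k) = 0 := by
  classical
  rw [eval_perPoly]
  simp only [Matrix.permanent, Matrix.of_apply]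
  simp_rw [prod_mrPoint, Finset.mem_univ, true_and]
  rw [Finset.sum_ite, Finset.sum_const, Finset.sum_const]
  have hA : (Finset.univ.filter fun π : Equiv.Perm (Fin (m + 3)) => π 0 = 0).card
      = (m + 2).factorial := by
    rw [← Fintype.card_subtype, card_perm_apply_eq_one, Fintype.card_fin]
    rfl
  have hAB := Finset.card_filter_add_card_filter_not
    (s := (Finset.univ : Finset (Equiv.Perm (Fin (m + 3))))) (fun π => π 0 = 0)
  rw [Finset.card_univ, Fintype.card_perm, Fintype.card_fin, hA, Nat.factorial_succ (m + 2)] at hAB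
  have hB : (Finset.univ.filter fun π : Equiv.Perm (Fin (m + 3)) => ¬ π 0 = 0).card
      = (m + 2) * (m + 2).factorial := by
    have := (m + 2).factorial_pos
    nlinarith [hAB]
  rw [hA, hB]
  simp only [nsmul_eq_mul]
  push_cast
  ring

/-- **Hessian of the permanent at the Mignon–Ressayre point** (Mignon–Ressayre 2004, §3;
Landsberg 2017, Exercise 6.4.6.2 / (6.4.3)): `H_{per}(y₀) = m! · mrHess`, i.e. the second partial
`∂_{cd}∂_{ab} per (y₀)` is `0` if `a = c` or `b = d`, `(m+1)!` if `0 ∈ {a, b, c, d}`, and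
`(m+1)! - (m+3) m! = -2 · m!` otherwise. [cite: LandsbergGCT2017, Exercise 6.4.6.2] -/
theorem hess0_transl_mrPoint_perPoly :
    hess0 (transl (mrPoint k m) (perPoly (Fin (m + 3)) k)) = (m.factorial : k) • mrHess k m := by
  classical
  ext ⟨c, d⟩ ⟨a, b⟩
  rw [hess0_transl_perPoly, Matrix.smul_apply, smul_eq_mul]
  simp only [mrHess, Matrix.of_apply]
  simp_rw [prod_mrPoint]
  have hmem : (0 : Fin (m + 3)) ∈ (Finset.univ.erase b).erase d ↔ b ≠ 0 ∧ d ≠ 0 := by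
    simp only [Finset.mem_erase, Finset.mem_univ, and_true, ne_comm (a := (0 : Fin (m + 3)))]
    tauto
  simp_rw [hmem]
  by_cases hbd : b = d
  · subst hbd
    simp
  by_cases hac : a = c
  · subst hac
    rw [if_pos (Or.inl rfl), mul_zero]
    refine Finset.sum_eq_zero fun π _ => ?_
    rw [if_neg]
    rintro ⟨h1, -, h3⟩
    exact hbd (π.injective (h1.trans h3.symm))
  rw [if_neg (by tauto)]
  have hC : ∀ π : Equiv.Perm (Fin (m + 3)), (π b = a ∧ d ≠ b ∧ π d = c) ↔ (π b = a ∧ π d = c) :=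
    fun π => ⟨fun h => ⟨h.1, h.2.2⟩, fun h => ⟨h.1, Ne.symm hbd, h.2⟩⟩
  simp_rw [hC]
  have h2 : (Finset.univ.filter fun π : Equiv.Perm (Fin (m + 3)) => π b = a ∧ π d = c).card
      = (m + 1).factorial := by
    rw [← Fintype.card_subtype, card_perm_apply_eq_two hbd hac, Fintype.card_fin]
    rfl
  by_cases hz : b ≠ 0 ∧ d ≠ 0
  · have hterm : ∀ π : Equiv.Perm (Fin (m + 3)),
        (if π b = a ∧ π d = c then (if (b ≠ 0 ∧ d ≠ 0) ∧ π 0 = 0 then -((m : k) + 2) else 1)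
          else 0) =
        (if π b = a ∧ π d = c then (1 : k) else 0) -
          ((m : k) + 3) * (if π b = a ∧ π d = c ∧ π 0 = 0 then 1 else 0) := by
      intro π
      by_cases hπ : π b = a ∧ π d = c
      · by_cases h0 : π 0 = 0
        · rw [if_pos hπ, if_pos ⟨hz, h0⟩, if_pos hπ, if_pos ⟨hπ.1, hπ.2, h0⟩]; ring
        · rw [if_pos hπ, if_neg (fun h => h0 h.2), if_pos hπ, if_neg (fun h => h0 h.2.2)]; ring
      · rw [if_neg hπ, if_neg hπ, if_neg (fun h => hπ ⟨h.1, h.2.1⟩)]; ring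
    rw [Finset.sum_congr rfl fun π _ => hterm π, Finset.sum_sub_distrib, ← Finset.mul_sum,
      Finset.sum_boole, Finset.sum_boole, h2]
    by_cases hz' : a ≠ 0 ∧ c ≠ 0
    · have h3 : (Finset.univ.filter fun π : Equiv.Perm (Fin (m + 3)) =>
          π b = a ∧ π d = c ∧ π 0 = 0).card = m.factorial := by
        rw [← Fintype.card_subtype, card_perm_apply_eq_three hbd hz.1 hz.2 hac hz'.1 hz'.2,
          Fintype.card_fin]
        rfl
      rw [h3, if_neg (by tauto), Nat.factorial_succ]
      push_cast
      ring
    · have h3 : (Finset.univ.filter fun π : Equiv.Perm (Fin (m + 3)) =>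
          π b = a ∧ π d = c ∧ π 0 = 0).card = 0 := by
        rw [Finset.card_eq_zero, Finset.filter_eq_empty_iff]
        rintro π - ⟨h1, h3, h0⟩
        rcases not_and_or.mp hz' with ha | hc
        · exact hz.1 (π.injective (h1.trans ((not_not.mp ha).trans h0.symm)))
        · exact hz.2 (π.injective (h3.trans ((not_not.mp hc).trans h0.symm)))
      rw [h3, if_pos (by tauto), Nat.factorial_succ]
      push_cast
      ring
  · have hterm : ∀ π : Equiv.Perm (Fin (m + 3)),
        (if π b = a ∧ π d = c then (if (b ≠ 0 ∧ d ≠ 0) ∧ π 0 = 0 then -((m : k) + 2) else 1)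
          else 0) = (if π b = a ∧ π d = c then (1 : k) else 0) := by
      intro π
      by_cases hπ : π b = a ∧ π d = c
      · rw [if_pos hπ, if_pos hπ, if_neg (fun h => hz h.1)]
      · rw [if_neg hπ, if_neg hπ]
    rw [Finset.sum_congr rfl fun π _ => hterm π, Finset.sum_boole, h2, if_pos (by tauto),
      Nat.factorial_succ]
    push_cast
    ring

end PermanentHessian

/-! ### Nonsingularity of the Mignon–Ressayre Hessian pattern -/

section MRHessianRank

variable {k : Type*} [Field k] [CharZero k] {m : ℕ}

/-- Injectivity of the block `Q = (m+1)(J - 1)` of (6.4.3) (Landsberg 2017, Lemma 6.4.6.3, where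
`Q` is assumed invertible): if `(m+1) Σ_{b ≠ d} y_b = 0` for every `d` then `y = 0`
(characteristic `0`). [cite: LandsbergGCT2017, Lemma 6.4.6.3] -/
theorem eq_zero_of_mrQ (y : Fin (m + 3) → k)
    (hy : ∀ d, ((m : k) + 1) * ∑ b ∈ Finset.univ.erase d, y b = 0) : y = 0 := by
  have hm1 : ((m : k) + 1) ≠ 0 := by exact_mod_cast (Nat.succ_ne_zero _ : m + 1 ≠ 0)
  have hm2 : ((m : k) + 2) ≠ 0 := by exact_mod_cast (Nat.succ_ne_zero _ : m + 2 ≠ 0)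
  have hsum : ∀ d, y d = ∑ b, y b := by
    intro d
    have h := hy d
    rw [Finset.sum_erase_eq_sub (Finset.mem_univ d)] at h
    exact (sub_eq_zero.mp ((mul_eq_zero.mp h).resolve_left hm1)).symm
  have hT : ((m : k) + 2) * ∑ b, y b = 0 := by
    have h : ∑ d : Fin (m + 3), y d = ∑ _d : Fin (m + 3), ∑ b, y b :=
      Finset.sum_congr rfl fun d _ => hsum d
    rw [Finset.sum_const, Finset.card_univ, Fintype.card_fin, nsmul_eq_mul] at h
    push_cast at h
    linear_combination -h
  have hT0 : ∑ b, y b = 0 := (mul_eq_zero.mp hT).resolve_left hm2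
  funext d
  rw [hsum d, hT0]
  rfl

/-- Injectivity of the block `R` of (6.4.3) (Landsberg 2017, Lemma 6.4.6.3, where `R` is assumed
invertible): if `Σ_{b ≠ d} r_{db} y_b = 0` for every `d`, where `r_{db} = m + 1` if `0 ∈ {b, d}`
and `r_{db} = -2` otherwise, then `y = 0` (characteristic `0`). [cite: LandsbergGCT2017, Lemma 6.4.6.3] -/
theorem eq_zero_of_mrR (y : Fin (m + 3) → k)
    (hy : ∀ d, ∑ b ∈ Finset.univ.erase d,
      (if d = 0 ∨ b = 0 then ((m : k) + 1) else -2) * y b = 0) : y = 0 := by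
  have hm1 : ((m : k) + 1) ≠ 0 := by exact_mod_cast (Nat.succ_ne_zero _ : m + 1 ≠ 0)
  have hm2 : ((m : k) + 2) ≠ 0 := by exact_mod_cast (Nat.succ_ne_zero _ : m + 2 ≠ 0)
  have hT : ∑ b ∈ Finset.univ.erase (0 : Fin (m + 3)), y b = 0 := by
    have h0 := hy 0
    simp only [true_or, if_true] at h0
    rw [← Finset.mul_sum] at h0
    exact (mul_eq_zero.mp h0).resolve_left hm1
  have hd : ∀ d : Fin (m + 3), d ≠ 0 → ((m : k) + 1) * y 0 + 2 * y d = 0 := by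
    intro d hd0
    have h := hy d
    have h0mem : (0 : Fin (m + 3)) ∈ Finset.univ.erase d :=
      Finset.mem_erase.mpr ⟨fun h => hd0 h.symm, Finset.mem_univ 0⟩
    rw [← Finset.add_sum_erase _ _ h0mem, if_pos (Or.inr rfl)] at h
    have hrest : ∑ b ∈ (Finset.univ.erase d).erase 0,
        (if d = 0 ∨ b = 0 then ((m : k) + 1) else -2) * y b =
        -2 * ∑ b ∈ (Finset.univ.erase d).erase 0, y b := by
      rw [Finset.mul_sum]
      refine Finset.sum_congr rfl fun b hb => ?_
      rw [if_neg (not_or.mpr ⟨hd0, (Finset.mem_erase.mp hb).1⟩)]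
    have hsub : ∑ b ∈ (Finset.univ.erase d).erase 0, y b =
        ∑ b ∈ Finset.univ.erase (0 : Fin (m + 3)), y b - y d := by
      rw [Finset.erase_right_comm,
        Finset.sum_erase_eq_sub (Finset.mem_erase.mpr ⟨hd0, Finset.mem_univ d⟩)]
    rw [hrest, hsub, hT] at h
    linear_combination h
  have hy0 : y 0 = 0 := by
    have hs : ∑ d ∈ Finset.univ.erase (0 : Fin (m + 3)), (((m : k) + 1) * y 0 + 2 * y d) = 0 :=
      Finset.sum_eq_zero fun d hd' => hd d (Finset.mem_erase.mp hd').1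
    rw [Finset.sum_add_distrib, Finset.sum_const, ← Finset.mul_sum, hT, mul_zero, add_zero,
      Finset.card_erase_of_mem (Finset.mem_univ _), Finset.card_univ, Fintype.card_fin,
      nsmul_eq_mul, show m + 3 - 1 = m + 2 from rfl] at hs
    push_cast at hs
    exact (mul_eq_zero.mp ((mul_eq_zero.mp hs).resolve_left hm2)).resolve_left hm1
  funext d
  by_cases hd0 : d = 0
  · rw [hd0, hy0]
    rfl
  · have h := hd d hd0
    rw [hy0, mul_zero, zero_add] at h
    exact (mul_eq_zero.mp h).resolve_left two_ne_zero

omit [CharZero k] in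
/-- Double sums with a row and a column index excluded. [folklore] -/
theorem sum_sum_ite_eq_or_eq {ι M : Type*} [Fintype ι] [DecidableEq ι] [AddCommMonoid M]
    (c d : ι) (f : ι → ι → M) :
    (∑ a, ∑ b, if a = c ∨ b = d then 0 else f a b) =
      ∑ a ∈ Finset.univ.erase c, ∑ b ∈ Finset.univ.erase d, f a b := by
  rw [← Finset.sum_erase_add _ _ (Finset.mem_univ c)]
  have hc : (∑ b, if c = c ∨ b = d then (0 : M) else f c b) = 0 :=
    Finset.sum_eq_zero fun b _ => if_pos (Or.inl rfl)
  rw [hc, add_zero]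
  refine Finset.sum_congr rfl fun a ha => ?_
  have hac : a ≠ c := (Finset.mem_erase.mp ha).1
  rw [← Finset.sum_erase_add _ _ (Finset.mem_univ d), if_pos (Or.inr rfl), add_zero]
  refine Finset.sum_congr rfl fun b hb => ?_
  exact if_neg (not_or.mpr ⟨hac, (Finset.mem_erase.mp hb).1⟩)

omit [CharZero k] in
/-- The `(c, d)` coordinate of `mrHess *ᵥ v`. [folklore] -/
theorem mrHess_mulVec_apply (v : Fin (m + 3) × Fin (m + 3) → k) (c d : Fin (m + 3)) :
    (mrHess k m *ᵥ v) (c, d) = ∑ a ∈ Finset.univ.erase c, ∑ b ∈ Finset.univ.erase d,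
      (if c = 0 ∨ d = 0 ∨ a = 0 ∨ b = 0 then ((m : k) + 1) else -2) * v (a, b) := by
  rw [← sum_sum_ite_eq_or_eq]
  simp only [Matrix.mulVec, dotProduct, Fintype.sum_prod_type, mrHess, Matrix.of_apply]
  refine Finset.sum_congr rfl fun a _ => Finset.sum_congr rfl fun b _ => ?_
  rw [ite_mul, zero_mul]

/-- **Landsberg 2017, Lemma 6.4.6.3** (kernel form, for the Hessian pattern of the permanent):
`mrHess v = 0` forces `v = 0` in characteristic `0`. Writing `v_a = v(a, ·)`, the block rows
give `Q (Σ_{a ≠ 0} v_a) = 0` and `Q v_0 + R Σ_{a ≠ 0, c} v_a = 0` (`c ≠ 0`); hence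
`Σ_{a ≠ 0} v_a = 0`, `Q v_0 = R v_c`, summing over `c` gives `(m+2) Q v_0 = 0`, so `v_0 = 0` and
then `R v_c = 0`, `v_c = 0`. [cite: LandsbergGCT2017, Lemma 6.4.6.3] -/
theorem mrHess_mulVec_eq_zero_imp (v : Fin (m + 3) × Fin (m + 3) → k)
    (hv : mrHess k m *ᵥ v = 0) : v = 0 := by
  have hm2 : ((m : k) + 2) ≠ 0 := by exact_mod_cast (Nat.succ_ne_zero _ : m + 2 ≠ 0)
  have hE : ∀ c d : Fin (m + 3), ∑ a ∈ Finset.univ.erase c, ∑ b ∈ Finset.univ.erase d,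
      (if c = 0 ∨ d = 0 ∨ a = 0 ∨ b = 0 then ((m : k) + 1) else -2) * v (a, b) = 0 := by
    intro c d
    rw [← mrHess_mulVec_apply, hv]
    rfl
  -- Step 1: the column sums over the rows `a ≠ 0` vanish.
  have hS : ∀ b, ∑ a ∈ Finset.univ.erase (0 : Fin (m + 3)), v (a, b) = 0 := by
    have hQ := eq_zero_of_mrQ (fun b => ∑ a ∈ Finset.univ.erase (0 : Fin (m + 3)), v (a, b))
      (fun d => by
        show ((m : k) + 1) * ∑ b ∈ Finset.univ.erase d,
          ∑ a ∈ Finset.univ.erase (0 : Fin (m + 3)), v (a, b) = 0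
        have h := hE 0 d
        simp only [true_or, if_true] at h
        rw [Finset.sum_comm] at h
        simpa only [← Finset.mul_sum] using h)
    exact fun b => congrFun hQ b
  -- Step 2: the rows `c ≠ 0`.
  have hE1 : ∀ c : Fin (m + 3), c ≠ 0 → ∀ d,
      ((m : k) + 1) * ∑ b ∈ Finset.univ.erase d, v (0, b) -
        ∑ b ∈ Finset.univ.erase d, (if d = 0 ∨ b = 0 then ((m : k) + 1) else -2) * v (c, b)
        = 0 := by
    intro c hc0 d
    have h := hE c d
    have h0mem : (0 : Fin (m + 3)) ∈ Finset.univ.erase c :=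
      Finset.mem_erase.mpr ⟨fun h => hc0 h.symm, Finset.mem_univ 0⟩
    rw [← Finset.add_sum_erase _ _ h0mem] at h
    have h1 : ∑ b ∈ Finset.univ.erase d,
        (if c = 0 ∨ d = 0 ∨ (0 : Fin (m + 3)) = 0 ∨ b = 0 then ((m : k) + 1) else -2) * v (0, b)
        = ((m : k) + 1) * ∑ b ∈ Finset.univ.erase d, v (0, b) := by
      rw [Finset.mul_sum]
      refine Finset.sum_congr rfl fun b _ => ?_
      rw [if_pos (Or.inr (Or.inr (Or.inl rfl)))]
    have h2 : ∑ a ∈ (Finset.univ.erase c).erase 0, ∑ b ∈ Finset.univ.erase d,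
        (if c = 0 ∨ d = 0 ∨ a = 0 ∨ b = 0 then ((m : k) + 1) else -2) * v (a, b)
        = ∑ b ∈ Finset.univ.erase d, (if d = 0 ∨ b = 0 then ((m : k) + 1) else -2) *
            ∑ a ∈ (Finset.univ.erase c).erase 0, v (a, b) := by
      rw [Finset.sum_comm]
      refine Finset.sum_congr rfl fun b _ => ?_
      rw [Finset.mul_sum]
      refine Finset.sum_congr rfl fun a ha => ?_
      have ha0 : a ≠ 0 := (Finset.mem_erase.mp ha).1
      congr 1
      exact if_congr (by simp only [hc0, ha0, false_or]) rfl rfl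
    have h3 : ∀ b, ∑ a ∈ (Finset.univ.erase c).erase 0, v (a, b) = -v (c, b) := by
      intro b
      rw [Finset.erase_right_comm,
        Finset.sum_erase_eq_sub (Finset.mem_erase.mpr ⟨hc0, Finset.mem_univ c⟩), hS b, zero_sub]
    rw [h1, h2] at h
    simp_rw [h3] at h
    simp only [mul_neg, Finset.sum_neg_distrib] at h
    linear_combination h
  -- Step 3: the row `0` vanishes.
  have hv0 : ∀ b, v (0, b) = 0 := by
    have hQ := eq_zero_of_mrQ (fun b => v (0, b)) (fun d => by
      show ((m : k) + 1) * ∑ b ∈ Finset.univ.erase d, v (0, b) = 0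
      have hs : ∑ c ∈ Finset.univ.erase (0 : Fin (m + 3)),
          (((m : k) + 1) * ∑ b ∈ Finset.univ.erase d, v (0, b) -
            ∑ b ∈ Finset.univ.erase d,
              (if d = 0 ∨ b = 0 then ((m : k) + 1) else -2) * v (c, b)) = 0 :=
        Finset.sum_eq_zero fun c hc => hE1 c (Finset.mem_erase.mp hc).1 d
      have h4 : ∑ c ∈ Finset.univ.erase (0 : Fin (m + 3)), ∑ b ∈ Finset.univ.erase d,
          (if d = 0 ∨ b = 0 then ((m : k) + 1) else -2) * v (c, b) = 0 := by
        rw [Finset.sum_comm]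
        refine Finset.sum_eq_zero fun b _ => ?_
        rw [← Finset.mul_sum, hS b, mul_zero]
      rw [Finset.sum_sub_distrib, h4, sub_zero, Finset.sum_const,
        Finset.card_erase_of_mem (Finset.mem_univ _), Finset.card_univ, Fintype.card_fin,
        nsmul_eq_mul, show m + 3 - 1 = m + 2 from rfl] at hs
      push_cast at hs
      exact (mul_eq_zero.mp hs).resolve_left hm2)
    exact fun b => congrFun hQ b
  -- Step 4: the rows `c ≠ 0` vanish.
  have hvc : ∀ c : Fin (m + 3), c ≠ 0 → ∀ b, v (c, b) = 0 := by
    intro c hc0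
    have hR := eq_zero_of_mrR (fun b => v (c, b)) (fun d => by
      show ∑ b ∈ Finset.univ.erase d,
        (if d = 0 ∨ b = 0 then ((m : k) + 1) else -2) * v (c, b) = 0
      have h := hE1 c hc0 d
      have h0 : ∑ b ∈ Finset.univ.erase d, v (0, b) = 0 :=
        Finset.sum_eq_zero fun b _ => hv0 b
      rwa [h0, mul_zero, zero_sub, neg_eq_zero] at h)
    exact fun b => congrFun hR b
  funext ⟨a, b⟩
  by_cases ha : a = 0
  · subst ha
    exact hv0 b
  · exact hvc a ha b

/-- The Hessian pattern `mrHess` has trivial kernel, as an injectivity statement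
(Landsberg 2017, Lemma 6.4.6.3). [cite: LandsbergGCT2017, Lemma 6.4.6.3] -/
theorem mrHess_mulVec_injective : Function.Injective (mrHess k m).mulVec := by
  intro v w h
  rw [← sub_eq_zero]
  apply mrHess_mulVec_eq_zero_imp
  rw [Matrix.mulVec_sub, h, sub_self]

/-- **The Hessian of `per_{m+3}` at the Mignon–Ressayre point has full rank `(m+3)²`**
(Mignon–Ressayre 2004, §3; Landsberg 2017, Lemma 6.4.6.3 with Exercise 6.4.6.2): the
pattern matrix `mrHess` is invertible in characteristic `0`. [cite: LandsbergGCT2017, Lemma 6.4.6.3] -/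
theorem rank_mrHess : (mrHess k m).rank = (m + 3) ^ 2 := by
  rw [Matrix.rank_of_isUnit _ (Matrix.mulVec_injective_iff_isUnit.mp mrHess_mulVec_injective),
    Fintype.card_prod, Fintype.card_fin, sq]

end MRHessianRank

/-! ### Assembly: the Mignon–Ressayre bound -/

section Assembly

/-- **Mignon–Ressayre, core inequality** (Mignon–Ressayre 2004, Thm. 1.1; Landsberg 2017,
Thm. 6.4.6.4): over a field of characteristic `0`, if `per_n = det A` for an `M × M` matrix `A` of
affine linear forms, `n ≥ 3`, then `n² ≤ 2M`. Proof: translate to the Mignon–Ressayre point `y₀`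
of `{per_n = 0}`; the Hessian of `det A(X + y₀) = per_n(X + y₀)` at `0` has rank `≤ 2M`
(`rank_hess0_det_le`) and equals `(n-3)! · mrHess`, of rank `n²` (`rank_mrHess`).
[cite: MignonRessayre2004, Thm. 1.1] -/
theorem sq_le_two_mul_of_hasDetRepr_perPoly {K : Type*} [Field K] [CharZero K] {m M : ℕ}
    (h : HasDetRepr (perPoly (Fin (m + 3)) K) M) : (m + 3) ^ 2 ≤ 2 * M := by
  obtain ⟨A, hA, hdet⟩ := h
  set A' : Matrix (Fin M) (Fin M) (MvPolynomial (Fin (m + 3) × Fin (m + 3)) K) :=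
    (transl (mrPoint K m)).mapMatrix A with hA'
  have hA'deg : ∀ i j, (A' i j).totalDegree ≤ 1 := fun i j =>
    (totalDegree_transl_le _ _).trans (hA i j)
  have hA'det : A'.det = transl (mrPoint K m) (perPoly (Fin (m + 3)) K) := by
    rw [hA', ← AlgHom.map_det, hdet]
  have h0 : constantCoeff A'.det = 0 := by
    rw [hA'det, constantCoeff_transl, eval_mrPoint_perPoly]
  have hrank := rank_hess0_det_le A' hA'deg h0
  rwa [hA'det, hess0_transl_mrPoint_perPoly,
    rank_smul_eq (by exact_mod_cast Nat.factorial_ne_zero m), rank_mrHess] at hrank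

/-- **Discharge of `sq_le_two_mul_determinantalComplexity_perPoly_complex`** (Mignon–Ressayre
2004, Thm. 1.1; Landsberg 2017, Thm. 6.4.6.4): for `n ≥ 3`, `n² ≤ 2 · dc(PER_n)` over `ℂ`. The
infimum defining `dc` is attained by Valiant universality (`exists_hasDetRepr_holds`), and the
attained representation satisfies `sq_le_two_mul_of_hasDetRepr_perPoly`.
[cite: MignonRessayre2004, Thm. 1.1] -/
theorem sq_le_two_mul_determinantalComplexity_perPoly_complex_holds :
    sq_le_two_mul_determinantalComplexity_perPoly_complex := by
  intro n hn
  obtain ⟨m, rfl⟩ : ∃ m, n = m + 3 := ⟨n - 3, by omega⟩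
  have hne : {M : ℕ | HasDetRepr (perPoly (Fin (m + 3)) ℂ) M}.Nonempty :=
    exists_hasDetRepr_holds _
  exact sq_le_two_mul_of_hasDetRepr_perPoly (Nat.sInf_mem hne)

end Assembly

end Literature.Computability.AlgebraicComplexity
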